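import Literature.Analysis.FluidPDE.LeiZhang2011EnergyEstimate
import Literature.Analysis.FluidPDE.LeiZhang2011ReverseHolder
import Literature.Analysis.FluidPDE.HolderThreeHalves
import HarnessLib

/-!
# Lei–Zhang 2011, §2: one step of Moser's iteration (the reverse Hölder inequality (2.5))

Analysis/FluidPDE proofs file (theorems only), on the discharge path of the named fact
`Literature.Analysis.FluidPDE.LeiZhang2011_liouville` (Z. Lei, Q. S. Zhang, J. Funct. Anal. 261
(2011) = arXiv:1011.5066, Theorem 1.2 via Theorem 1.1). The analytic core of one Moser step,
(2.4)–(2.5) of the paper: for the tested quantity `H(F)` (`H = f²∘|·|^{1/q}` in the paper's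
notation, `f = |Γ|^q`) on nested parabolic cylinders
`(−T₂, 0) × B(r₂) ⊂ (−T₁, 0] × B̄(r₁)`,

`∬_{(−T₂,0)×B(r₂)} H(F)^{5/3} ≤ K_step · (∬_{(−T₁,0]×B̄(r₁)} H(F)^{3/2})^{10/9}`

(`LeiZhang2011.reverse_holder_step`), with an explicit
`K_step = (5/2) C_S² ((c₁ |B̄(r₁)|^{1/3} + c₂) T₁^{1/3})^{5/3}`, `c₁ = 4κD² + D'`,
`c₂ = 4κ D² C_J C_B² |B(r₁)|^{1/3}` (`D`, `D'` the gradient bounds of the cut-offs, `C_B` the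
`BMO` bound of the stream function, `C_J` the John–Nirenberg constant, `C_S` the Sobolev constant,
`κ` the structure constant of `H`). Assembled from the tree's `energy_inequality_of_majorant`
(applied on `[−T₁, t]` for every `t ≤ 0`), `sup_le_and_integral_le_of_energy_ineq`,
`lintegral_tenThirds_mul_comp_le` (Sobolev step), `integral_comp_mul_norm_sub_sq_mul_norm_gradient_sq_le`
(Hölder on the stream term) and `intervalIntegral_cutoff_terms_le` (Hölder bookkeeping). The
John–Nirenberg bound of the stream oscillation enters as the hypothesis `hc`
(discharged by `exists_setIntegral_norm_sub_sq_cube_le`).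

## References

* Z. Lei, Q. S. Zhang, J. Funct. Anal. 261 (2011) = arXiv:1011.5066, §2 (2.4)–(2.5), pp. 7–8.
  [LeiZhang2011]
-/

noncomputable section

open MeasureTheory Set Function Filter Metric intervalIntegral
open _root_.Topology
open scoped InnerProductSpace RealInnerProductSpace NNReal ENNReal Laplacian

namespace Literature.Analysis.FluidPDE

namespace LeiZhang2011

open Literature.Analysis.FunctionSpaces

/-- `ofReal |s|^{10/3} = ofReal (s²)^{5/3}`. [folklore] -/
theorem ofReal_abs_rpow_tenThirds (v : ℝ) :
    ENNReal.ofReal |v| ^ (10 / 3 : ℝ) = ENNReal.ofReal (v ^ 2) ^ (5 / 3 : ℝ) := by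
  rw [ENNReal.ofReal_rpow_of_nonneg (abs_nonneg v) (by norm_num),
    ENNReal.ofReal_rpow_of_nonneg (sq_nonneg v) (by norm_num)]
  congr 1
  rw [← sq_abs, ← Real.rpow_natCast |v| 2, ← Real.rpow_mul (abs_nonneg v)]
  norm_num

/-- **Tonelli for a jointly continuous nonnegative integrand on `(t₁, 0] × K`**:
`ofReal (∫_{t₁}^0 ∫_K f) = ∬_{(t₁,0]×K} ofReal f`, `K` compact. [folklore] -/
theorem ofReal_intervalIntegral_setIntegral_eq_lintegral_prod
    {f : ℝ → EuclideanSpace ℝ (Fin 3) → ℝ} (hf : Continuous fun p : ℝ × EuclideanSpace ℝ (Fin 3) => f p.1 p.2)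
    (hf0 : ∀ s x, 0 ≤ f s x) {K : Set (EuclideanSpace ℝ (Fin 3))} (hK : IsCompact K)
    {t₁ : ℝ} (ht : t₁ ≤ 0) :
    ENNReal.ofReal (∫ s in t₁..0, ∫ x in K, f s x) =
      ∫⁻ p in Ioc t₁ 0 ×ˢ K, ENNReal.ofReal (f p.1 p.2) ∂((volume : Measure ℝ).prod volume) := by
  have hmeasf : Measurable fun p : ℝ × EuclideanSpace ℝ (Fin 3) => ENNReal.ofReal (f p.1 p.2) :=
    ENNReal.measurable_ofReal.comp hf.measurable
  rw [← Measure.prod_restrict, lintegral_prod _ hmeasf.aemeasurable]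
  have hYc : Continuous fun s => ∫ x in K, f s x :=
    continuous_parametric_integral_of_continuous (f := f) hf hK
  have hinner : ∀ s, ∫⁻ x in K, ENNReal.ofReal (f s x) = ENNReal.ofReal (∫ x in K, f s x) := by
    intro s
    have hi : IntegrableOn (fun x => f s x) K volume :=
      (hf.comp (continuous_const.prodMk continuous_id)).continuousOn.integrableOn_compact hK
    rw [ofReal_integral_eq_lintegral_ofReal hi (ae_of_all _ fun x => hf0 s x)]
  simp_rw [hinner]
  have hYi : IntegrableOn (fun s => ∫ x in K, f s x) (Ioc t₁ 0) volume :=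
    (hYc.integrableOn_Icc).mono_set Ioc_subset_Icc_self
  rw [← ofReal_integral_eq_lintegral_ofReal hYi (ae_of_all _ fun s => integral_nonneg fun x => hf0 s x),
    intervalIntegral.integral_of_le ht]

/-- **The interior cylinder sees `H(F)^{5/3}` as `|φ s_H(F)|^{10/3}`**: if `φ = 1` on `B(0,r₂)` and
`s_H² = H`, then `∬_{I×B(0,r₂)} ofReal(H(F))^{5/3} ≤ ∬_{(vol|I) ⊗ vol} ofReal|φ s_H(F)|^{10/3}`.
[folklore] -/
theorem setLIntegral_rpow_fiveThirds_le_lintegral_mul_comp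
    {F : ℝ → EuclideanSpace ℝ (Fin 3) → ℝ} {H sH : ℝ → ℝ} (hsH2 : ∀ v, sH v ^ 2 = H v)
    {φ : EuclideanSpace ℝ (Fin 3) → ℝ} {r₂ : ℝ}
    (hφ1 : ∀ x ∈ ball (0 : EuclideanSpace ℝ (Fin 3)) r₂, φ x = 1) (I : Set ℝ) :
    ∫⁻ p in I ×ˢ ball (0 : EuclideanSpace ℝ (Fin 3)) r₂,
        ENNReal.ofReal (H (F p.1 p.2)) ^ (5 / 3 : ℝ) ∂((volume : Measure ℝ).prod volume) ≤
      ∫⁻ p, ENNReal.ofReal |φ p.2 * sH (F p.1 p.2)| ^ (10 / 3 : ℝ) ∂((volume.restrict I).prod volume) := by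
  have hmeas : MeasurableSet (univ ×ˢ ball (0 : EuclideanSpace ℝ (Fin 3)) r₂ : Set (ℝ × EuclideanSpace ℝ (Fin 3))) :=
    MeasurableSet.univ.prod measurableSet_ball
  have e1 : ((volume : Measure ℝ).prod (volume : Measure (EuclideanSpace ℝ (Fin 3)))).restrict
      (I ×ˢ ball 0 r₂) = ((volume.restrict I).prod volume).restrict (univ ×ˢ ball 0 r₂) := by
    rw [← Measure.prod_restrict, ← Measure.prod_restrict, Measure.restrict_univ]
  calc ∫⁻ p in I ×ˢ ball (0 : EuclideanSpace ℝ (Fin 3)) r₂,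
        ENNReal.ofReal (H (F p.1 p.2)) ^ (5 / 3 : ℝ) ∂((volume : Measure ℝ).prod volume)
      = ∫⁻ p in univ ×ˢ ball (0 : EuclideanSpace ℝ (Fin 3)) r₂,
          ENNReal.ofReal (H (F p.1 p.2)) ^ (5 / 3 : ℝ) ∂((volume.restrict I).prod volume) := by rw [e1]
    _ = ∫⁻ p in univ ×ˢ ball (0 : EuclideanSpace ℝ (Fin 3)) r₂,
          ENNReal.ofReal |φ p.2 * sH (F p.1 p.2)| ^ (10 / 3 : ℝ) ∂((volume.restrict I).prod volume) := by
        refine setLIntegral_congr_fun hmeas fun p hp => ?_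
        have hx : p.2 ∈ ball (0 : EuclideanSpace ℝ (Fin 3)) r₂ := hp.2
        simp only [hφ1 p.2 hx, one_mul, ofReal_abs_rpow_tenThirds, hsH2]
    _ ≤ _ := setLIntegral_le_lintegral _ _

/-- The final arithmetic of the Moser step: from `LHS ≤ C² ℛ^{2/3} · (5/2)ℛ` and `ℛ ≤ L X^{2/3}`
to `LHS ≤ (5/2) C² L^{5/3} · X^{10/9}` (in `ℝ≥0∞`). [folklore] -/
theorem moser_step_arith {LHS : ℝ≥0∞} {C : ℝ≥0} {ℛ L X : ℝ} (hℛ0 : 0 ≤ ℛ) (hL0 : 0 ≤ L)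
    (hX0 : 0 ≤ X) (h : LHS ≤ (C : ℝ≥0∞) ^ 2 * ENNReal.ofReal ℛ ^ (2 / 3 : ℝ) * ENNReal.ofReal (5 / 2 * ℛ))
    (hℛL : ℛ ≤ L * X ^ (2 / (3 : ℝ))) :
    LHS ≤ ENNReal.ofReal (5 / 2 * (C : ℝ) ^ 2 * L ^ (5 / 3 : ℝ)) * ENNReal.ofReal X ^ (10 / 9 : ℝ) := by
  refine h.trans ?_
  have e2 : (C : ℝ≥0∞) ^ 2 * ENNReal.ofReal ℛ ^ (2 / 3 : ℝ) * ENNReal.ofReal (5 / 2 * ℛ) =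
      ENNReal.ofReal (5 / 2 * (C : ℝ) ^ 2 * ℛ ^ (5 / 3 : ℝ)) := by
    rw [ENNReal.ofReal_rpow_of_nonneg hℛ0 (by norm_num),
      show ((C : ℝ≥0∞)) ^ 2 = ENNReal.ofReal ((C : ℝ) ^ 2) by
        rw [ENNReal.ofReal_pow (NNReal.coe_nonneg _), ENNReal.ofReal_coe_nnreal],
      ← ENNReal.ofReal_mul (by positivity), ← ENNReal.ofReal_mul (by positivity)]
    congr 1
    have : ℛ ^ (2 / 3 : ℝ) * ℛ = ℛ ^ (5 / 3 : ℝ) := by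
      rw [show (5 / 3 : ℝ) = 2 / 3 + 1 by norm_num, Real.rpow_add' hℛ0 (by norm_num), Real.rpow_one]
    calc (C : ℝ) ^ 2 * ℛ ^ (2 / 3 : ℝ) * (5 / 2 * ℛ) = 5 / 2 * (C : ℝ) ^ 2 * (ℛ ^ (2 / 3 : ℝ) * ℛ) := by ring
      _ = 5 / 2 * (C : ℝ) ^ 2 * ℛ ^ (5 / 3 : ℝ) := by rw [this]
  rw [e2]
  have e3 : ℛ ^ (5 / 3 : ℝ) ≤ L ^ (5 / 3 : ℝ) * X ^ (10 / 9 : ℝ) := by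
    calc ℛ ^ (5 / 3 : ℝ) ≤ (L * X ^ (2 / (3 : ℝ))) ^ (5 / 3 : ℝ) :=
          Real.rpow_le_rpow hℛ0 hℛL (by norm_num)
      _ = L ^ (5 / 3 : ℝ) * X ^ (10 / 9 : ℝ) := by
          rw [Real.mul_rpow hL0 (Real.rpow_nonneg hX0 _), ← Real.rpow_mul hX0]
          norm_num
  calc ENNReal.ofReal (5 / 2 * (C : ℝ) ^ 2 * ℛ ^ (5 / 3 : ℝ))
      ≤ ENNReal.ofReal (5 / 2 * (C : ℝ) ^ 2 * (L ^ (5 / 3 : ℝ) * X ^ (10 / 9 : ℝ))) := by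
        refine ENNReal.ofReal_le_ofReal ?_
        exact mul_le_mul_of_nonneg_left e3 (by positivity)
    _ = ENNReal.ofReal (5 / 2 * (C : ℝ) ^ 2 * L ^ (5 / 3 : ℝ)) * ENNReal.ofReal X ^ (10 / 9 : ℝ) := by
        rw [ENNReal.ofReal_rpow_of_nonneg hX0 (by norm_num), ← ENNReal.ofReal_mul (by positivity)]
        ring_nf

/-- **One step of Moser's iteration (Lei–Zhang 2011, (2.4)–(2.5)).** See the module docstring
for the setting and the constant. Hypotheses: the equation data of `energy_inequality_of_majorant`
on `[−T₁, 0]` (with the stream function and its `BMO` bound for a.e. `s`, and the John–Nirenberg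
`L⁶` bound `hc` of its oscillation over `B̄(r₁)`), a convex `H ∈ C²` with `H(0) = 0`,
`H'² ≤ κHH''`, `κ ≥ 1`, a `C¹` square root `s_H` (`s_H² = H`, `2s_H'² ≤ H''`), space and time
cut-offs adapted to the two cylinders with gradient bounds `D`, `D'`, the space–time
integrability of the tested equation, the slice functionals integrable in time, and `H(F)` jointly
continuous. [cite: LeiZhang2011, §2 (2.4)–(2.5) (arXiv pp. 7–8)] -/
theorem reverse_holder_step
    {r₁ r₂ T₁ T₂ : ℝ} (hT₂ : 0 < T₂) (hT : T₂ < T₁)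
    {F N : ℝ → EuclideanSpace ℝ (Fin 3) → ℝ}
    {b Bst : ℝ → EuclideanSpace ℝ (Fin 3) → EuclideanSpace ℝ (Fin 3)}
    {c : ℝ → EuclideanSpace ℝ (Fin 3)}
    (hF2 : ∀ s, ContDiff ℝ 2 (F s)) (hFa : ∀ s, IsAxisymmetricScalar (F s))
    (hF0 : ∀ s x, cylRadius x = 0 → F s x = 0)
    (hb : ∀ s, LocallyIntegrable (b s) volume)
    (hBst : ∀ᵐ s ∂(volume.restrict (Ioc (-T₁) 0)),
      Differentiable ℝ (Bst s) ∧ curl (Bst s) =ᵐ[volume] b s)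
    (hN : ∀ s x, N s x =
      (Δ (F s)) x - fderiv ℝ (F s) x (b s x) - 2 / cylRadius x * fderiv ℝ (F s) x (eR x))
    (heq : ∀ᵐ x ∂(volume : Measure (EuclideanSpace ℝ (Fin 3))),
      IntervalIntegrable (fun s => N s x) volume (-T₁) 0 ∧
        ∀ s ∈ Icc (-T₁) 0, F s x = F (-T₁) x + ∫ τ in (-T₁)..s, N τ x)
    -- the nonlinearity
    {H sH : ℝ → ℝ} (hH : ContDiff ℝ 2 H) (hH00 : H 0 = 0) (hH0 : ∀ v, 0 ≤ H v)
    (hH2 : ∀ v, 0 ≤ deriv (deriv H) v) {κ : ℝ} (hκ1 : 1 ≤ κ)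
    (hκ : ∀ v, deriv H v ^ 2 ≤ κ * H v * deriv (deriv H) v)
    (hsH : ContDiff ℝ 1 sH) (hsH2 : ∀ v, sH v ^ 2 = H v)
    (hsH' : ∀ v, 2 * deriv sH v ^ 2 ≤ deriv (deriv H) v)
    -- the cut-offs
    {φ : EuclideanSpace ℝ (Fin 3) → ℝ} (hφ : ContDiff ℝ 2 φ) (hφc : HasCompactSupport φ)
    (hφa : IsAxisymmetricScalar φ) (hφr : ∀ x, φ x * fderiv ℝ φ x (eR x) ≤ 0)
    (hφ1 : ∀ x ∈ ball (0 : EuclideanSpace ℝ (Fin 3)) r₂, φ x = 1)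
    (hφK : tsupport φ ⊆ closedBall (0 : EuclideanSpace ℝ (Fin 3)) r₁)
    (hφ01 : ∀ x, 0 ≤ φ x ∧ φ x ≤ 1) {D : ℝ} (hφD : ∀ x, ‖gradient φ x‖ ≤ D)
    {η : ℝ → ℝ} (hη : ContDiff ℝ 1 η) (hη1 : η (-T₁) = 0) (hη2 : ∀ s, -T₂ ≤ s → η s = 1)
    (hη01 : ∀ s, 0 ≤ η s ∧ η s ≤ 1) {D' : ℝ} (hηD : ∀ s, |deriv η s| ≤ D')
    -- space–time integrability of the tested equation
    (hint : Integrable (fun p : ℝ × EuclideanSpace ℝ (Fin 3) =>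
      (deriv H (F p.1 p.2) * N p.1 p.2 * η p.1 + H (F p.1 p.2) * deriv η p.1) * φ p.2 ^ 2)
      ((volume.restrict (Ioc (-T₁) 0)).prod volume))
    -- the slice functionals on `[−T₁, 0]`
    {G T₁f T₂f T₃f M : ℝ → ℝ}
    (hG : ∀ s, G s = ∫ x, deriv (deriv H) (F s x) * ‖gradient (F s) x‖ ^ 2 * φ x ^ 2)
    (hT₁f : ∀ s, T₁f s = ∫ x, deriv H (F s x) * ⟪gradient (F s) x, gradient (fun y => φ y ^ 2) x⟫)
    (hT₂f : ∀ s, T₂f s = ∫ x, H (F s x) * ⟪b s x, gradient (fun y => φ y ^ 2) x⟫)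
    (hT₃f : ∀ s, T₃f s = ∫ x, 2 / cylRadius x * (H (F s x) * fderiv ℝ (fun y => φ y ^ 2) x (eR x)))
    (hM : ∀ s, M s = ∫ x, H (F s x) * φ x ^ 2)
    (hGi : IntervalIntegrable G volume (-T₁) 0) (hT₁i : IntervalIntegrable T₁f volume (-T₁) 0)
    (hT₂i : IntervalIntegrable T₂f volume (-T₁) 0) (hT₃i : IntervalIntegrable T₃f volume (-T₁) 0)
    (hMi : IntervalIntegrable M volume (-T₁) 0)
    -- joint continuity of `H(F)`
    (hHFc : Continuous fun p : ℝ × EuclideanSpace ℝ (Fin 3) => H (F p.1 p.2))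
    -- the John–Nirenberg `L⁶` bound of the stream oscillation over `B̄(r₁)`
    {CB CJ : ℝ} (hCJ : 0 ≤ CJ)
    (hc : ∀ᵐ s ∂(volume.restrict (Ioc (-T₁) 0)),
      (∫ x in closedBall (0 : EuclideanSpace ℝ (Fin 3)) r₁, (‖Bst s x - c s‖ ^ 2) ^ (3 : ℝ)) ^ (1 / (3 : ℝ)) ≤
        CJ * CB ^ 2 * (volume.real (ball (0 : EuclideanSpace ℝ (Fin 3)) r₁)) ^ (1 / (3 : ℝ))) :
    ∫⁻ p in Ioo (-T₂) 0 ×ˢ ball (0 : EuclideanSpace ℝ (Fin 3)) r₂,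
        ENNReal.ofReal (H (F p.1 p.2)) ^ (5 / 3 : ℝ) ∂((volume : Measure ℝ).prod volume) ≤
      ENNReal.ofReal ((5 / 2) *
        (SNormLESNormFDerivOfEqConst ℝ (volume : Measure (EuclideanSpace ℝ (Fin 3))) 2 : ℝ) ^ 2 *
        (((4 * κ * D ^ 2 + D') * (volume.real (closedBall (0 : EuclideanSpace ℝ (Fin 3)) r₁)) ^ (1 / (3 : ℝ)) +
            4 * κ * D ^ 2 * CJ * CB ^ 2 * (volume.real (ball (0 : EuclideanSpace ℝ (Fin 3)) r₁)) ^ (1 / (3 : ℝ))) *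
          T₁ ^ (1 / (3 : ℝ))) ^ (5 / 3 : ℝ)) *
      (∫⁻ p in Ioc (-T₁) 0 ×ˢ closedBall (0 : EuclideanSpace ℝ (Fin 3)) r₁,
        ENNReal.ofReal (H (F p.1 p.2)) ^ (3 / 2 : ℝ) ∂((volume : Measure ℝ).prod volume)) ^ (10 / 9 : ℝ) := by
  -- ### notation and elementary facts
  set K : Set (EuclideanSpace ℝ (Fin 3)) := closedBall 0 r₁ with hK
  have hKc : IsCompact K := isCompact_closedBall _ _
  have hT₁ : 0 < T₁ := hT₂.trans hT
  have ht₁ : -T₁ ≤ 0 := by linarith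
  have hD0 : 0 ≤ D := (norm_nonneg _).trans (hφD 0)
  have hD'0 : 0 ≤ D' := (abs_nonneg _).trans (hηD 0)
  have hκ0 : 0 ≤ κ := zero_le_one.trans hκ1
  set Vb : ℝ := volume.real (ball (0 : EuclideanSpace ℝ (Fin 3)) r₁) with hVb
  set c₁ : ℝ := 4 * κ * D ^ 2 + D' with hc₁
  set c₂ : ℝ := 4 * κ * D ^ 2 * CJ * CB ^ 2 * Vb ^ (1 / (3 : ℝ)) with hc₂
  have hc₁0 : 0 ≤ c₁ := by positivity
  have hVb0 : 0 ≤ Vb := measureReal_nonneg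
  have hc₂0 : 0 ≤ c₂ := by positivity
  -- the slice functionals of the majorant
  set A : ℝ → ℝ := fun s => ∫ x in K, H (F s x) with hA
  set Y : ℝ → ℝ := fun s => ∫ x in K, H (F s x) ^ ((3 : ℝ) / 2) with hY
  set Rm : ℝ → ℝ := fun s => c₁ * A s + c₂ * Y s ^ (2 / (3 : ℝ)) with hRm
  have hHF32 : Continuous fun p : ℝ × EuclideanSpace ℝ (Fin 3) => H (F p.1 p.2) ^ ((3 : ℝ) / 2) :=
    hHFc.rpow_const fun p => Or.inr (by norm_num)
  have hAc : Continuous A :=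
    continuous_parametric_integral_of_continuous (f := fun s x => H (F s x)) hHFc hKc
  have hYc : Continuous Y :=
    continuous_parametric_integral_of_continuous (f := fun s x => H (F s x) ^ ((3 : ℝ) / 2)) hHF32 hKc
  have hA0 : ∀ s, 0 ≤ A s := fun s => integral_nonneg fun x => hH0 _
  have hY0 : ∀ s, 0 ≤ Y s := fun s => integral_nonneg fun x => Real.rpow_nonneg (hH0 _) _
  have hRmc : Continuous Rm :=
    (continuous_const.mul hAc).add (continuous_const.mul (hYc.rpow_const fun s => Or.inr (by norm_num)))
  have hRm0 : ∀ s, 0 ≤ Rm s := fun s =>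
    add_nonneg (mul_nonneg hc₁0 (hA0 s)) (mul_nonneg hc₂0 (Real.rpow_nonneg (hY0 s) _))
  -- support facts for `φ`
  have hφ2c : HasCompactSupport fun y => φ y ^ 2 :=
    hφc.comp_left (g := fun t : ℝ => t ^ 2) (zero_pow two_ne_zero)
  have hφ0K : ∀ x, x ∉ K → φ x = 0 := fun x hx => image_eq_zero_of_notMem_tsupport fun h => hx (hφK h)
  have hgradφ0 : ∀ x, x ∉ K → gradient φ x = 0 := fun x hx =>
    gradient_eq_zero_of_notMem_tsupport fun h => hx (hφK h)
  -- `M ≤ A`, `P ≤ D² A` (slice-wise)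
  have hHFs : ∀ s, Continuous fun x => H (F s x) := fun s => hH.continuous.comp (hF2 s).continuous
  have hMle : ∀ s, M s ≤ A s := by
    intro s
    rw [hM s, ← setIntegral_eq_integral_of_forall_compl_eq_zero (s := K) (fun x hx => by
      rw [hφ0K x hx]; ring)]
    refine setIntegral_mono_on (((hHFs s).mul (hφ.continuous.pow 2)).continuousOn.integrableOn_compact hKc)
      ((hHFs s).continuousOn.integrableOn_compact hKc) hKc.measurableSet fun x _ => ?_
    have h1 : φ x ^ 2 ≤ 1 := by
      have := hφ01 x; nlinarith
    calc H (F s x) * φ x ^ 2 ≤ H (F s x) * 1 := mul_le_mul_of_nonneg_left h1 (hH0 _)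
      _ = H (F s x) := mul_one _
  have hPle : ∀ s, ∫ x, H (F s x) * ‖gradient φ x‖ ^ 2 ≤ D ^ 2 * A s := by
    intro s
    rw [← setIntegral_eq_integral_of_forall_compl_eq_zero (s := K) (fun x hx => by
      rw [hgradφ0 x hx, norm_zero]; ring), hA, ← MeasureTheory.integral_const_mul]
    have hgc : Continuous (gradient φ) := continuous_gradient_of_contDiff (hφ.of_le (by norm_num))
    refine setIntegral_mono_on (((hHFs s).mul (hgc.norm.pow 2)).continuousOn.integrableOn_compact hKc)
      ((continuous_const.mul (hHFs s)).continuousOn.integrableOn_compact hKc) hKc.measurableSet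
      fun x _ => ?_
    have h1 : ‖gradient φ x‖ ^ 2 ≤ D ^ 2 := pow_le_pow_left₀ (norm_nonneg _) (hφD x) 2
    calc H (F s x) * ‖gradient φ x‖ ^ 2 ≤ H (F s x) * D ^ 2 := mul_le_mul_of_nonneg_left h1 (hH0 _)
      _ = D ^ 2 * H (F s x) := by ring
  -- `Q ≤ D² C_J C_B² |B|^{1/3} Y^{2/3}` for a.e. `s` (John–Nirenberg)
  have hQle : ∀ᵐ s ∂(volume.restrict (Ioc (-T₁) 0)),
      ∫ x, H (F s x) * ‖Bst s x - c s‖ ^ 2 * ‖gradient φ x‖ ^ 2 ≤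
        D ^ 2 * (CJ * CB ^ 2 * Vb ^ (1 / (3 : ℝ))) * Y s ^ (2 / (3 : ℝ)) := by
    filter_upwards [hBst, hc] with s hBs hcs
    have h := integral_comp_mul_norm_sub_sq_mul_norm_gradient_sq_le (hF2 s).continuous hH.continuous
      hH0 (hφ.of_le (by norm_num)) hKc hφK hφD hBs.1.continuous (c s)
    refine h.trans ?_
    have e : (∫ x in K, H (F s x) ^ ((3 : ℝ) / 2)) ^ (1 / ((3 : ℝ) / 2)) = Y s ^ (2 / (3 : ℝ)) := by
      rw [hY]; norm_num
    rw [e]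
    have hY23 : 0 ≤ Y s ^ (2 / (3 : ℝ)) := Real.rpow_nonneg (hY0 s) _
    calc D ^ 2 * ((∫ x in K, (‖Bst s x - c s‖ ^ 2) ^ (3 : ℝ)) ^ (1 / (3 : ℝ)) * Y s ^ (2 / (3 : ℝ)))
        ≤ D ^ 2 * ((CJ * CB ^ 2 * Vb ^ (1 / (3 : ℝ))) * Y s ^ (2 / (3 : ℝ))) := by
          gcongr
      _ = D ^ 2 * (CJ * CB ^ 2 * Vb ^ (1 / (3 : ℝ))) * Y s ^ (2 / (3 : ℝ)) := by ring
  -- ### Step 1: the energy inequality on `[−T₁, t]` for every `t ∈ [−T₁, 0]`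
  have hEI : ∀ t ∈ Icc (-T₁) 0,
      η t * M t + 1 / 2 * ∫ s in (-T₁)..t, η s * G s ≤ ∫ s in (-T₁)..t, Rm s := by
    intro t ht
    have hsubI : Icc (-T₁) t ⊆ Icc (-T₁) 0 := Icc_subset_Icc le_rfl ht.2
    have hsub : Ioc (-T₁) t ⊆ Ioc (-T₁) 0 := Ioc_subset_Ioc le_rfl ht.2
    have huIcc : uIcc (-T₁) t ⊆ uIcc (-T₁) 0 := by
      rw [uIcc_of_le ht.1, uIcc_of_le ht₁]; exact hsubI
    -- restrictions of the hypotheses to `[−T₁, t]`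
    have hBst_t : ∀ᵐ s ∂(volume.restrict (Ioc (-T₁) t)),
        Differentiable ℝ (Bst s) ∧ curl (Bst s) =ᵐ[volume] b s :=
      ae_restrict_of_ae_restrict_of_subset hsub hBst
    have heq_t : ∀ᵐ x ∂(volume : Measure (EuclideanSpace ℝ (Fin 3))),
        IntervalIntegrable (fun s => N s x) volume (-T₁) t ∧
          ∀ s ∈ Icc (-T₁) t, F s x = F (-T₁) x + ∫ τ in (-T₁)..s, N τ x := by
      filter_upwards [heq] with x hx
      exact ⟨hx.1.mono_set huIcc, fun s hs => hx.2 s (hsubI hs)⟩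
    have hint_t : Integrable (fun p : ℝ × EuclideanSpace ℝ (Fin 3) =>
        (deriv H (F p.1 p.2) * N p.1 p.2 * η p.1 + H (F p.1 p.2) * deriv η p.1) * φ p.2 ^ 2)
        ((volume.restrict (Ioc (-T₁) t)).prod volume) :=
      hint.mono_measure (Measure.prod_mono (Measure.restrict_mono hsub le_rfl) le_rfl)
    have hR_t : ∀ᵐ s ∂(volume.restrict (Ioc (-T₁) t)),
        η s * (κ / (1 / 4)) * ((∫ x, H (F s x) * ‖gradient φ x‖ ^ 2) +
          ∫ x, H (F s x) * ‖Bst s x - c s‖ ^ 2 * ‖gradient φ x‖ ^ 2) + |deriv η s| * M s ≤ Rm s := by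
      have hQ_t := ae_restrict_of_ae_restrict_of_subset hsub hQle
      filter_upwards [hQ_t] with s hQs
      have hηs := hη01 s
      have hP := hPle s
      have hMs := hMle s
      have hMs0 : 0 ≤ M s := by rw [hM s]; exact integral_nonneg fun x => mul_nonneg (hH0 _) (sq_nonneg _)
      have hsum0 : 0 ≤ (∫ x, H (F s x) * ‖gradient φ x‖ ^ 2) +
          ∫ x, H (F s x) * ‖Bst s x - c s‖ ^ 2 * ‖gradient φ x‖ ^ 2 :=
        add_nonneg (integral_nonneg fun x => mul_nonneg (hH0 _) (sq_nonneg _))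
          (integral_nonneg fun x => mul_nonneg (mul_nonneg (hH0 _) (sq_nonneg _)) (sq_nonneg _))
      have h1 : η s * (κ / (1 / 4)) * ((∫ x, H (F s x) * ‖gradient φ x‖ ^ 2) +
          ∫ x, H (F s x) * ‖Bst s x - c s‖ ^ 2 * ‖gradient φ x‖ ^ 2) ≤
          4 * κ * (D ^ 2 * A s + D ^ 2 * (CJ * CB ^ 2 * Vb ^ (1 / (3 : ℝ))) * Y s ^ (2 / (3 : ℝ))) := by
        have h2 : η s * (κ / (1 / 4)) ≤ 4 * κ := by
          rw [show κ / (1 / 4) = 4 * κ by ring]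
          exact mul_le_of_le_one_left (by positivity) hηs.2
        calc η s * (κ / (1 / 4)) * ((∫ x, H (F s x) * ‖gradient φ x‖ ^ 2) +
              ∫ x, H (F s x) * ‖Bst s x - c s‖ ^ 2 * ‖gradient φ x‖ ^ 2)
            ≤ 4 * κ * ((∫ x, H (F s x) * ‖gradient φ x‖ ^ 2) +
              ∫ x, H (F s x) * ‖Bst s x - c s‖ ^ 2 * ‖gradient φ x‖ ^ 2) :=
              mul_le_mul_of_nonneg_right h2 hsum0
          _ ≤ 4 * κ * (D ^ 2 * A s + D ^ 2 * (CJ * CB ^ 2 * Vb ^ (1 / (3 : ℝ))) * Y s ^ (2 / (3 : ℝ))) :=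
              mul_le_mul_of_nonneg_left (add_le_add hP hQs) (by positivity)
      have h3 : |deriv η s| * M s ≤ D' * A s :=
        mul_le_mul (hηD s) hMs hMs0 hD'0
      calc η s * (κ / (1 / 4)) * ((∫ x, H (F s x) * ‖gradient φ x‖ ^ 2) +
            ∫ x, H (F s x) * ‖Bst s x - c s‖ ^ 2 * ‖gradient φ x‖ ^ 2) + |deriv η s| * M s
          ≤ 4 * κ * (D ^ 2 * A s + D ^ 2 * (CJ * CB ^ 2 * Vb ^ (1 / (3 : ℝ))) * Y s ^ (2 / (3 : ℝ))) +
            D' * A s := add_le_add h1 h3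
        _ = Rm s := by simp only [hRm, hc₁, hc₂]; ring
    have h := energy_inequality_of_majorant (t₁ := -T₁) (t₂ := t) ht.1 hF2 hFa hF0 hb hBst_t hN heq_t
      hH hH00 hH0 hH2 hκ0 hκ hφ hφc hφa hφr hη (fun s _ => (hη01 s).1) hη1
      (ε := 1 / 4) (by norm_num) hint_t hG hT₁f hT₂f hT₃f hM
      (hGi.mono_set huIcc) (hT₁i.mono_set huIcc) (hT₂i.mono_set huIcc) (hT₃i.mono_set huIcc)
      (hMi.mono_set huIcc) hR_t ((hRmc.intervalIntegrable _ _).mono_set huIcc)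
    have e : (1 : ℝ) - 2 * (1 / 4) = 1 / 2 := by norm_num
    rw [e] at h
    exact h
  -- ### Step 2: `sup M ≤ ℛ`, `∫ G ≤ 2ℛ`
  set ℛ : ℝ := ∫ s in (-T₁)..0, Rm s with hℛ
  have hG0 : ∀ s, 0 ≤ G s := fun s => by
    rw [hG s]; exact integral_nonneg fun x => mul_nonneg (mul_nonneg (hH2 _) (sq_nonneg _)) (sq_nonneg _)
  have hM0 : ∀ s, 0 ≤ M s := fun s => by
    rw [hM s]; exact integral_nonneg fun x => mul_nonneg (hH0 _) (sq_nonneg _)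
  obtain ⟨hMsup, hGint⟩ := sup_le_and_integral_le_of_energy_ineq (t₁ := -T₁) (T₂ := T₂)
    (by linarith) hT₂.le hEI (fun s => (hη01 s).1) (fun s hs => hη2 s hs.1) hM0
    (fun s _ => hG0 s) (fun s _ => hRm0 s) (hGi.continuousOn_mul hη.continuous.continuousOn)
    (hRmc.intervalIntegrable _ _)
  have hℛ0 : 0 ≤ ℛ := intervalIntegral.integral_nonneg ht₁ fun s _ => hRm0 s
  -- ### Step 3: `ℛ ≤ L X^{2/3}`
  set X : ℝ := ∫ s in (-T₁)..0, Y s with hX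
  have hX0 : 0 ≤ X := intervalIntegral.integral_nonneg ht₁ fun s _ => hY0 s
  set L : ℝ := (c₁ * (volume.real K) ^ (1 / (3 : ℝ)) + c₂) * T₁ ^ (1 / (3 : ℝ)) with hL
  have hL0 : 0 ≤ L := by positivity
  have hℛL : ℛ ≤ L * X ^ (2 / (3 : ℝ)) := by
    have h := intervalIntegral_cutoff_terms_le (F := F) (H := H) hHFc (fun s x => hH0 _) hKc ht₁ hc₁0 hc₂0
    rw [neg_neg] at h
    exact h
  -- ### Step 4: the Sobolev step on `ν = vol|(−T₂, 0)`
  set ν : Measure ℝ := volume.restrict (Ioo (-T₂) 0) with hν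
  have hIooI : Ioo (-T₂) (0 : ℝ) ⊆ Icc (-T₂) 0 := Ioo_subset_Icc_self
  have hM_ae : ∀ᵐ s ∂ν, ∫ x, H (F s x) * φ x ^ 2 ≤ ℛ := by
    refine (ae_restrict_iff' measurableSet_Ioo).2 (ae_of_all _ fun s hs => ?_)
    rw [← hM s]; exact hMsup s (hIooI hs)
  set Pf : ℝ → ℝ := fun s => ∫ x, H (F s x) * ‖gradient φ x‖ ^ 2 with hPf
  have hPfc : Continuous Pf := by
    have hgc : Continuous (gradient φ) := continuous_gradient_of_contDiff (hφ.of_le (by norm_num))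
    have hjc : Continuous fun p : ℝ × EuclideanSpace ℝ (Fin 3) => H (F p.1 p.2) * ‖gradient φ p.2‖ ^ 2 :=
      hHFc.mul ((hgc.comp continuous_snd).norm.pow 2)
    have h := continuous_parametric_integral_of_continuous
      (μ := (volume : Measure (EuclideanSpace ℝ (Fin 3))))
      (f := fun s x => H (F s x) * ‖gradient φ x‖ ^ 2) hjc hKc
    refine (h.congr fun s => ?_)
    exact setIntegral_eq_integral_of_forall_compl_eq_zero fun x hx => by
      rw [hgradφ0 x hx, norm_zero]; ring
  set W : ℝ → ℝ := fun s => G s + 2 * Pf s with hW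
  have hWm : AEMeasurable W ν := by
    have hGm : AEStronglyMeasurable G ν := by
      have h := (hGi.mono_set (show uIcc (-T₂) 0 ⊆ uIcc (-T₁) 0 by
        rw [uIcc_of_le (by linarith : -T₂ ≤ (0:ℝ)), uIcc_of_le ht₁]
        exact Icc_subset_Icc (by linarith) le_rfl)).1
      exact h.aestronglyMeasurable.mono_measure (Measure.restrict_mono Ioo_subset_Ioc_self le_rfl)
    exact (hGm.aemeasurable.add ((hPfc.aemeasurable.const_mul 2).mono_measure Measure.restrict_le_self))
  have hSob := lintegral_tenThirds_mul_comp_le (fun s => (hF2 s).of_le (by norm_num)) hH hH0 hH2 hsH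
    hsH2 hsH' (hφ.of_le (by norm_num)) hφc (ν := ν) hM_ae hWm (fun s => by simp only [hW, hG, hPf])
  -- ### Step 5: `∫ W dν ≤ (5/2) ℛ`
  have hPint : ∫ s in (-T₂)..0, Pf s ≤ ℛ / 4 := by
    -- `4κ D² A ≤ Rm`, `Pf ≤ D² A`, `κ ≥ 1`
    have h1 : ∫ s in (-T₂)..0, Pf s ≤ ∫ s in (-T₁)..0, Pf s := by
      refine integral_mono_interval (by linarith) (by linarith) le_rfl ?_ (hPfc.intervalIntegrable _ _)
      exact ae_of_all _ fun s => integral_nonneg fun x => mul_nonneg (hH0 _) (sq_nonneg _)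
    have h2 : ∫ s in (-T₁)..0, Pf s ≤ ∫ s in (-T₁)..0, Rm s / 4 := by
      refine intervalIntegral.integral_mono_on ht₁ (hPfc.intervalIntegrable _ _)
        ((hRmc.div_const 4).intervalIntegrable _ _) fun s _ => ?_
      have hPA := hPle s
      have : 4 * κ * D ^ 2 * A s ≤ Rm s := by
        simp only [hRm, hc₁]
        nlinarith [mul_nonneg hc₂0 (Real.rpow_nonneg (hY0 s) (2 / (3 : ℝ))), mul_nonneg hD'0 (hA0 s)]
      have hDA : D ^ 2 * A s ≤ κ * (D ^ 2 * A s) :=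
        le_mul_of_one_le_left (mul_nonneg (sq_nonneg _) (hA0 s)) hκ1
      simp only [hPf] at hPA ⊢
      linarith
    rw [intervalIntegral.integral_div] at h2
    linarith
  have hWint : ∫ s in (-T₂)..0, W s ≤ 5 / 2 * ℛ := by
    have hGi' : IntervalIntegrable G volume (-T₂) 0 := hGi.mono_set (by
      rw [uIcc_of_le (by linarith : -T₂ ≤ (0:ℝ)), uIcc_of_le ht₁]
      exact Icc_subset_Icc (by linarith) le_rfl)
    rw [hW, intervalIntegral.integral_add hGi' ((hPfc.intervalIntegrable _ _).const_mul 2),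
      intervalIntegral.integral_const_mul]
    linarith
  have hW0 : ∀ s, 0 ≤ W s := fun s =>
    add_nonneg (hG0 s) (mul_nonneg zero_le_two (integral_nonneg fun x => mul_nonneg (hH0 _) (sq_nonneg _)))
  have hWlint : ∫⁻ s, ENNReal.ofReal (W s) ∂ν ≤ ENNReal.ofReal (5 / 2 * ℛ) := by
    have hWi : IntegrableOn W (Ioo (-T₂) 0) volume := by
      have hGi' : IntervalIntegrable G volume (-T₂) 0 := hGi.mono_set (by
        rw [uIcc_of_le (by linarith : -T₂ ≤ (0:ℝ)), uIcc_of_le ht₁]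
        exact Icc_subset_Icc (by linarith) le_rfl)
      have h := (hGi'.add ((hPfc.intervalIntegrable _ _).const_mul 2)).1
      exact h.mono_set Ioo_subset_Ioc_self
    rw [hν, ← ofReal_integral_eq_lintegral_ofReal hWi (ae_of_all _ hW0)]
    refine ENNReal.ofReal_le_ofReal ?_
    rw [integral_Ioc_eq_integral_Ioo.symm, ← intervalIntegral.integral_of_le (by linarith : -T₂ ≤ (0:ℝ))]
    exact hWint
  -- ### Step 6: the left-hand side is dominated by `∬ |φ s_H(F)|^{10/3}`
  have hLHS := setLIntegral_rpow_fiveThirds_le_lintegral_mul_comp (F := F) (H := H) hsH2 hφ1 (Ioo (-T₂) 0)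
  -- ### Step 7: the right-hand side integral is `ofReal X`
  have hXlint : ENNReal.ofReal X = ∫⁻ p in Ioc (-T₁) 0 ×ˢ K,
      ENNReal.ofReal (H (F p.1 p.2)) ^ (3 / 2 : ℝ) ∂((volume : Measure ℝ).prod volume) := by
    have h := ofReal_intervalIntegral_setIntegral_eq_lintegral_prod
      (f := fun s x => H (F s x) ^ ((3 : ℝ) / 2)) hHF32 (fun s x => Real.rpow_nonneg (hH0 _) _) hKc ht₁
    rw [hX]
    refine h.trans (lintegral_congr fun p => ?_)
    rw [ENNReal.ofReal_rpow_of_nonneg (hH0 _) (by norm_num)]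
  -- ### Step 8: assemble
  have hmain : ∫⁻ p in Ioo (-T₂) 0 ×ˢ ball (0 : EuclideanSpace ℝ (Fin 3)) r₂,
        ENNReal.ofReal (H (F p.1 p.2)) ^ (5 / 3 : ℝ) ∂((volume : Measure ℝ).prod volume) ≤
      (SNormLESNormFDerivOfEqConst ℝ (volume : Measure (EuclideanSpace ℝ (Fin 3))) 2 : ℝ≥0∞) ^ 2 *
        ENNReal.ofReal ℛ ^ (2 / 3 : ℝ) * ENNReal.ofReal (5 / 2 * ℛ) :=
    hLHS.trans (hSob.trans (mul_le_mul_right hWlint _))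
  rw [← hXlint]
  exact moser_step_arith hℛ0 hL0 hX0 hmain hℛL

end LeiZhang2011

end Literature.Analysis.FluidPDE
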